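import Literature.Computability.Complexity.DrivenSignMachine
import HarnessLib

/-!
# The oracle-driven sign machine, II: the stream, the frame calculus, `P⁰_ℝovs(A)` from a driver

Topic `Literature/Computability/Complexity`, grouping namespace `FKTransfer`, sequel of
`DrivenSignMachine.lean` (the driven sign machine `drvAlg m P T`: sign rounds `i < T(n)`,
`P(n) ∣ i + 1`, asking the sign of the form coded by the last `m(n)` answer bits; driver rounds
asking the Boolean oracle the whole transcript `⟨1ⁿ, bits⟩`; verdict = last answer bit). Here the
machine disappears:

* `stream δ σ m P T i` — the transcript after `i` rounds as a plain recursion on a DRIVER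
  `δ : List Bool → Bool` and a SIGN ENVIRONMENT `σ : List Bool → Bool`; `stream_succ_of_sign`,
  `stream_succ_of_drive`, `stream_T_succ`, `stream_take`, `driveBits`/`stream_add_of_drive` and the
  **frame calculus** `stream_frame` (a frame = `P - 1` driver rounds, in which the driver may record
  the answers to its own `NP` questions — prefix search, Fournier–Koiran §2.1 — and spell out a
  query, followed by one sign round on the last `m` bits);
* `driverOf A n`, `signEnv x`, **`adBits_drvQ_eq_stream`** — the transcript of `drvAlg` against
  `signOracleWith A x` on `1ⁿ` IS the stream of `driverOf A n` and `signEnv x`; `mem_adLang_drv_iff`,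
  `run_drvAlg` (the output bit is the driver's verdict `[⟨1ⁿ, stream T(n)⟩ ∈ A]`);
* **`mem_PAddRel_of_driver`**, **`mem_PAddRelClass_of_driver`** — `L ∈ PAddRel A`
  (resp. `∈ PAddRelClass C` for `A ∈ C`) as soon as the verdict is `[x ∈ L n]` for all `n`, `x`.

So Fournier–Koiran's Theorem 3 (`NDP⁰_ℝovs ⊆ P⁰_ℝovs(NP)`, report p. 11) is reduced to a DRIVER
LANGUAGE `A ∈ NP` and a statement about streams: its frames locate `x` in the arrangement of the
verifier's test hyperplanes (report §2, Thm 2) and its verdict is the `NP` question of p. 11.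

## References

* H. Fournier, P. Koiran, *Lower bounds are not easier over the reals: inside PH*, ICALP 2000,
  LNCS 1853 = LIP RR-1999-21, §2 (p. 4: the oracle model; §2.1: prefix search with an `NP` oracle),
  §3 Thm 3 (p. 11). [FournierKoiran2000]
-/

namespace Literature.Computability.Complexity

namespace FKTransfer

open _root_.Computability Polynomial Brick AdQuery

/-- Length of a unary numeral. [folklore] -/
private theorem length_unaryEncodeNat (k : ℕ) : (unaryEncodeNat k).length = k := by
  induction k with
  | zero => rfl
  | succ k ih => rw [unaryEncodeNat, List.length_cons, ih]

/-! ### The stream: a machine-free model of the transcript -/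

section Stream

variable (δ σ : List Bool → Bool) (m P T : ℕ)

/-- The response of round `i = |bits|`: the sign environment on the payload in a sign round, the
driver on the transcript otherwise. [folklore] -/
def respond (bits : List Bool) : Bool :=
  if bits.length < T ∧ (bits.length + 1) % P = 0 then σ (bits.drop (bits.length - m)) else δ bits

/-- **The stream** of answer bits of the driven machine with driver `δ` and sign environment `σ`:
`stream (i+1) = stream i ++ [respond (stream i)]`. [folklore] -/
def stream : ℕ → List Bool
  | 0 => []
  | i + 1 => stream i ++ [respond δ σ m P T (stream i)]

variable {δ σ m P T}

/-- `stream 0 = []`. [folklore] -/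
@[simp] theorem stream_zero : stream δ σ m P T 0 = [] := rfl

/-- One more round. [folklore] -/
theorem stream_succ (i : ℕ) : stream δ σ m P T (i + 1) = stream δ σ m P T i ++ [respond δ σ m P T (stream δ σ m P T i)] :=
  rfl

/-- The stream after `i` rounds has `i` bits. [folklore] -/
@[simp] theorem length_stream : ∀ i, (stream δ σ m P T i).length = i
  | 0 => rfl
  | i + 1 => by rw [stream_succ, List.length_append, length_stream i, List.length_singleton]

/-- **A sign round** appends the sign bit of the payload (the last `m` bits). [folklore] -/
theorem stream_succ_of_sign {i : ℕ} (hi : i < T) (hP : (i + 1) % P = 0) :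
    stream δ σ m P T (i + 1) = stream δ σ m P T i ++ [σ ((stream δ σ m P T i).drop (i - m))] := by
  rw [stream_succ, respond, length_stream, if_pos ⟨hi, hP⟩]

/-- **A driver round** appends the driver's bit on the transcript. [folklore] -/
theorem stream_succ_of_drive {i : ℕ} (h : ¬ (i < T ∧ (i + 1) % P = 0)) :
    stream δ σ m P T (i + 1) = stream δ σ m P T i ++ [δ (stream δ σ m P T i)] := by
  rw [stream_succ, respond, length_stream, if_neg h]

/-- The final round `T` is a driver round: the verdict. [folklore] -/
theorem stream_T_succ : stream δ σ m P T (T + 1) = stream δ σ m P T T ++ [δ (stream δ σ m P T T)] :=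
  stream_succ_of_drive fun h => lt_irrefl _ h.1

/-- Earlier streams are prefixes of later ones. [folklore] -/
theorem stream_take {i j : ℕ} (h : i ≤ j) : (stream δ σ m P T j).take i = stream δ σ m P T i := by
  induction j with
  | zero =>
    obtain rfl : i = 0 := Nat.le_zero.1 h
    rfl
  | succ j ih =>
    rcases Nat.lt_or_eq_of_le h with hlt | rfl
    · rw [stream_succ, List.take_append_of_le_length (by rw [length_stream]; omega)]
      exact ih (by omega)
    · rw [List.take_of_length_le (by rw [length_stream])]

/-- The bits a driver produces in `k` consecutive driver rounds after the history `hist`. [folklore] -/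
def driveBits (δ : List Bool → Bool) (hist : List Bool) : ℕ → List Bool
  | 0 => []
  | k + 1 => driveBits δ hist k ++ [δ (hist ++ driveBits δ hist k)]

/-- `driveBits` produces `k` bits. [folklore] -/
@[simp] theorem length_driveBits (hist : List Bool) : ∀ k, (driveBits δ hist k).length = k
  | 0 => rfl
  | k + 1 => by rw [driveBits, List.length_append, length_driveBits hist k, List.length_singleton]

/-- Consecutive driver rounds from round `i₀`: if none of the rounds `i₀, …, i₀ + k - 1` is a sign
round then `stream (i₀ + k) = stream i₀ ++ driveBits δ (stream i₀) k`. [folklore] -/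
theorem stream_add_of_drive (i₀ : ℕ) : ∀ k, (∀ j < k, ¬ (i₀ + j < T ∧ (i₀ + j + 1) % P = 0)) →
    stream δ σ m P T (i₀ + k) = stream δ σ m P T i₀ ++ driveBits δ (stream δ σ m P T i₀) k
  | 0, _ => by simp [driveBits]
  | k + 1, h => by
    rw [← Nat.add_assoc, stream_succ_of_drive (h k (Nat.lt_succ_self k)),
      stream_add_of_drive i₀ k (fun j hj => h j (Nat.lt_succ_of_lt hj)), driveBits, List.append_assoc]

/-- **The frame calculus.** With period `P ≥ 1`, the frame starting at round `f · P` (with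
`f · P + P ≤ T`) consists of `P - 1` driver rounds followed by one sign round:
`stream (f P + P) = stream (f P) ++ d ++ [σ (payload)]`, where `d = driveBits δ (stream (f P)) (P - 1)`
and the payload is the last `m` bits of `stream (f P) ++ d`. [cite: FournierKoiran2000, §2.1 (prefix search with an `NP` oracle, then a test)] -/
theorem stream_frame {f : ℕ} (hP : 1 ≤ P) (hf : f * P + P ≤ T) :
    stream δ σ m P T (f * P + P) =
      stream δ σ m P T (f * P) ++ driveBits δ (stream δ σ m P T (f * P)) (P - 1) ++
        [σ ((stream δ σ m P T (f * P) ++ driveBits δ (stream δ σ m P T (f * P)) (P - 1)).drop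
          (f * P + (P - 1) - m))] := by
  have hdrive : ∀ j < P - 1, ¬ (f * P + j < T ∧ (f * P + j + 1) % P = 0) := by
    intro j hj ⟨_, h0⟩
    have h1 : (f * P + j + 1) % P = j + 1 := by
      rw [show f * P + j + 1 = j + 1 + f * P by omega, Nat.add_mul_mod_self_right,
        Nat.mod_eq_of_lt (by omega)]
    omega
  have h1 := stream_add_of_drive (δ := δ) (σ := σ) (m := m) (P := P) (T := T) (f * P) (P - 1) hdrive
  have hsign : stream δ σ m P T (f * P + (P - 1) + 1) =
      stream δ σ m P T (f * P + (P - 1)) ++ [σ ((stream δ σ m P T (f * P + (P - 1))).drop (f * P + (P - 1) - m))] := by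
    refine stream_succ_of_sign (by omega) ?_
    rw [show f * P + (P - 1) + 1 = (f + 1) * P by rw [Nat.succ_mul]; omega]
    exact Nat.mul_mod_left _ _
  rw [show f * P + P = f * P + (P - 1) + 1 by omega, hsign, h1]

end Stream

/-! ### The transcript of the driven machine is the stream -/

section Semantics

variable {m P T : Polynomial ℕ} {k : ℕ}

/-- The driver defined by a Boolean oracle `A` in dimension `n`: `bits ↦ [⟨1ⁿ, bits⟩ ∈ A]`. [folklore] -/
noncomputable def driverOf (A : Language Bool) (n : ℕ) (bits : List Bool) : Bool :=
  A.boolIndicator (boolPair (unaryEncodeNat n) bits)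

/-- The sign environment of a point `x`: `w ↦ [0 ≤ form_w(x)]` (the bit of `signOracle x w`). [folklore] -/
noncomputable def signEnv (x : Fin k → ℝ) (w : List Bool) : Bool :=
  decide ((0 : ℝ) ≤ affineQueryValue x w)

/-- The sign oracle answers with the sign environment's bit. [folklore] -/
theorem signOracle_eq_signEnv (x : Fin k → ℝ) (w : List Bool) : signOracle x w = encodeBool (signEnv x w) := rfl

/-- **The transcript of the driven machine against `signOracleWith A x` is the stream** of the
driver `driverOf A n` and the environment `signEnv x`, with the parameters evaluated at `n`.
[cite: FournierKoiran2000, §2 (p. 4)] -/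
theorem adBits_drvQ_eq_stream (A : Language Bool) (x : Fin k → ℝ) (n : ℕ) : ∀ i,
    adBits (drvQ m P T) (tagLang A x) (unaryEncodeNat n) i =
      stream (driverOf A n) (signEnv x) (m.eval n) (P.eval n) (T.eval n) i
  | 0 => rfl
  | i + 1 => by
    rw [adBits_succ, adBits_drvQ_eq_stream A x n i, stream_succ, drvQ_apply, respond, length_stream]
    split_ifs with h
    · rw [boolIndicator_tagLang_false_cons]; rfl
    · rw [boolIndicator_tagLang_true_cons]; rfl

/-- **The reduced language of the driven machine**: with round polynomial `T + 1`, `1ⁿ` is accepted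
iff the driver accepts the final stream `⟨1ⁿ, stream T(n)⟩`. [cite: FournierKoiran2000, §3 Thm 3 (p. 11)] -/
theorem mem_adLang_drv_iff (A : Language Bool) (x : Fin k → ℝ) (n : ℕ) :
    unaryEncodeNat n ∈ adLang (drvQ m P T) (T + 1) BrainProtocol.Verdict (tagLang A x) ↔
      boolPair (unaryEncodeNat n)
        (stream (driverOf A n) (signEnv x) (m.eval n) (P.eval n) (T.eval n) (T.eval n)) ∈ A := by
  rw [mem_adLang_iff, length_unaryEncodeNat, eval_add, eval_one, adBits_drvQ_eq_stream, stream_T_succ,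
    boolPair_append_singleton_mem_Verdict, driverOf]
  exact (Set.mem_iff_boolIndicator _ _).symm

/-- **The run of the driven machine**: with round budget `T(n) + 2`, against `signOracleWith A x` on
input `1ⁿ`, `drvAlg m P T` outputs the driver's verdict `[⟨1ⁿ, stream T(n)⟩ ∈ A]`.
[cite: FournierKoiran2000, §3 Thm 3 (p. 11)] -/
theorem run_drvAlg (A : Language Bool) (x : Fin k → ℝ) (n : ℕ) :
    (drvAlg m P T).run (signOracleWith A x) (T.eval n + 2) (unaryEncodeNat n) =
      some (A.boolIndicator (boolPair (unaryEncodeNat n)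
        (stream (driverOf A n) (signEnv x) (m.eval n) (P.eval n) (T.eval n) (T.eval n)))) := by
  rw [drvAlg, signOracleWith_eq_ofLanguage, run_adAlg (tagLang A x) (unaryEncodeNat n)
    (by rw [eval_add, eval_one, length_unaryEncodeNat]; omega)]
  congr 1
  by_cases h : boolPair (unaryEncodeNat n)
      (stream (driverOf A n) (signEnv x) (m.eval n) (P.eval n) (T.eval n) (T.eval n)) ∈ A
  · rw [(Set.mem_iff_boolIndicator _ _).1 h, (Set.mem_iff_boolIndicator _ _).1 ((mem_adLang_drv_iff A x n).2 h)]
  · rw [(Set.notMem_iff_boolIndicator _ _).1 h,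
      (Set.notMem_iff_boolIndicator _ _).1 (fun h' => h ((mem_adLang_drv_iff A x n).1 h'))]

end Semantics

/-! ### Main results -/

/-- **`P⁰_ℝovs(A)`-membership from a driver.** If for every dimension `n` and every `x ∈ ℝⁿ` the
driver `A` accepts the final stream `⟨1ⁿ, stream T(n)⟩` of the driven sign machine exactly when
`x ∈ L n`, then `L ∈ PAddRel A` — the machine being `drvAlg m P T` with round
budget `T + 2`. [cite: FournierKoiran2000, §2 (p. 4) and §3 Thm 3 (p. 11)] -/
theorem mem_PAddRel_of_driver (m P T : Polynomial ℕ) (A : Language Bool) (L : RealLanguage)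
    (h : ∀ (n : ℕ) (x : Fin n → ℝ),
      boolPair (unaryEncodeNat n)
        (stream (driverOf A n) (signEnv x) (m.eval n) (P.eval n) (T.eval n) (T.eval n)) ∈ A ↔ x ∈ L n) :
    L ∈ PAddRel A :=
  mem_PAddRel_of_adLang (q := T + 1) drvQ_mem_FP BrainProtocol.Verdict_mem_P fun n x =>
    (mem_adLang_drv_iff A x n).trans (h n x)

/-- **`P⁰_ℝovs(C)`-membership from a driver in `C`** (e.g. `C = NP`: the shape of Fournier–Koiran's
Theorem 3, whose driver performs the point location of §2 and answers the `NP` question of p. 11).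
[cite: FournierKoiran2000, §3 Thm 3 (p. 11)] -/
theorem mem_PAddRelClass_of_driver (m P T : Polynomial ℕ) {C : Set (Language Bool)} {A : Language Bool}
    (hA : A ∈ C) (L : RealLanguage)
    (h : ∀ (n : ℕ) (x : Fin n → ℝ),
      boolPair (unaryEncodeNat n)
        (stream (driverOf A n) (signEnv x) (m.eval n) (P.eval n) (T.eval n) (T.eval n)) ∈ A ↔ x ∈ L n) :
    L ∈ PAddRelClass C :=
  PAddRel_subset_PAddRelClass hA (mem_PAddRel_of_driver m P T A L h)

end FKTransfer

end Literature.Computability.Complexity
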